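import Literature.NumberTheory.GaloisRepresentations.SemiLocalUnitGroupUnramifiedH1
import Literature.NumberTheory.GaloisRepresentations.SemiLocalUnitGroupUnramifiedNorm
import Literature.NumberTheory.NumberFields.DecompositionGroupsPrescribed
import Literature.NumberTheory.GaloisRepresentations.FrobeniusDensityTheorem
import Literature.Algebra.Homology.TateCohomologyFiniteCyclic
import HarnessLib

/-!
# The local units at an unramified place have trivial cohomology:
# `Ĥⁿ(Gal(E_w/F_v), 𝒪_wˣ) = 0` for all `n ∈ ℤ` and `Hⁿ(Gal(E/F), ∏_{w ∣ v} 𝒪_wˣ) = 0` for all `n ≥ 1`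
# (Harari Prop. 13.1 (b), proof: "`Ĥ^i(G, U_K(v)) = Ĥ^i(G_v, U_{K,v}) = 0`"; Tate, C–F VII §7.3)

Topic `NumberTheory/GaloisRepresentations`; namespace `Literature.NumberTheory.GaloisRepresentations.SemiLocal`.
The capstone of the chain `SemiLocalShapiro` → `SemiLocalUnitGroupShapiro` → `SemiLocalUnitGroupUnramifiedH1`
(`H¹(K, 𝒪_wˣ) = 0` for every `K ≤ Gal(E_w/F_v)` at `e(w|v) = 1`, from the valuation sequence and Hilbert 90)
→ `SemiLocalUnitGroupUnramifiedNorm` (`Ĥ⁰(Gal(E_w/F_v), 𝒪_wˣ) = 0`: units are norms, from the tree's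
Childress Lemma 5.3 (a)).  Theorems only; NO definition, no named fact, no `sorry`, no instance; number
fields in `Type`.

Mathematics.  Let `E/F` be Galois with group `G`, `v` a finite place of `F` unramified in `E`
(`Algebra.IsUnramifiedIn (𝓞 E) v`), `w ∣ v`.  Then the decomposition group `G_w ≃* Gal(E_w/F_v)` is
CYCLIC, generated by the Frobenius (Neukirch I (9.4); tree `stabilizer_eq_zpowers_of_isArithFrobAt` +
`exists_isArithFrobAt_ringOfIntegers`), so the Tate cohomology of any `Gal(E_w/F_v)`-module is periodic of
period two (Serre VIII §4; engine `FiniteCyclic.tateCohomologyIsoOfEvenIff`).  With `Ĥ⁰ = 0` and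
`Ĥ¹ = H¹ = 0` for the module `𝒪_wˣ` this gives `Ĥⁿ(Gal(E_w/F_v), 𝒪_wˣ) = 0` for every `n ∈ ℤ`, in
particular `Hⁿ = 0` for `n ≥ 1`; Shapiro (`groupCohomologyUnitGroupRepIsoAut`) transports the latter to
`Hⁿ(Gal(E/F), ∏_{w∣v} 𝒪_wˣ) = 0`, `n ≥ 1` — the vanishing Harari and Tate use to pass from the `S`-idèles
to the idèles.  (The route through cyclicity is Serre's for unramified extensions of local fields; it
avoids the cohomological-triviality criterion over all subgroups, whose degree-`0` input would need the
norm theorem for every sub-layer `E_w/E_w^K`.)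

## What is formalised (`F E : Type`, `[IsGalois F E]`, `w : Place F E v`, `hunr : Algebra.IsUnramifiedIn (𝓞 E) v.asIdeal`)

* §1 `stabilizer_place_eq` (the stabiliser of `w : Place F E v` is that of the underlying place of `E`),
  **`isCyclic_stabilizer`** (`G_w` is cyclic at an unramified place), **`isCyclic_algEquiv_place`**
  (`Gal(E_w/F_v)` is cyclic), `ramificationIdx_place_eq_one` (`e(w|v) = 1`).
* §2 (generic) `isZero_tateCohomology_of_isCyclic`: for a finite cyclic group, `Ĥ⁰ = Ĥ¹ = 0 ⟹ Ĥⁿ = 0`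
  for all `n ∈ ℤ` (the engine's periodicity, with `IsCyclic.commGroup`).
* §3 **`isZero_tateCohomology_placeUnitGroupRep`** (`Ĥⁿ(Gal(E_w/F_v), 𝒪_wˣ) = 0`, all `n ∈ ℤ`, any
  `Fintype` structure), **`isZero_groupCohomology_placeUnitGroupRep`** (`Hⁿ = 0`, `n ≥ 1`),
  `isZero_groupCohomology_localIntUnitsRep` (`G_w` form), and
  **`isZero_groupCohomology_unitGroupRep`: `Hⁿ(Gal(E/F), ∏_{w ∣ v} 𝒪_wˣ) = 0` for every `n ≥ 1`**,
  `isZero_groupCohomology_unitGroupRep'` (place chosen internally), `isZero_tateCohomology_unitGroupRep_of_nonneg`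
  (`Ĥⁿ(Gal(E/F), ∏_{w∣v} 𝒪_wˣ) = 0` for `n ≥ 0`).

Not here: Tate degrees `≤ -1` of the `G`-module `∏_{w∣v} 𝒪_wˣ` (Shapiro for Tate cohomology), the
cohomological triviality over all subgroups, the `S`-idèle decomposition and the limit over `S`.

## References
* D. Harari, *Galois Cohomology and Class Field Theory*, Springer (2020), §13.1 proof of Prop. 13.1 (b),
  Prop. 8.3. [Harari2020]
* J.-P. Serre, *Local Fields*, GTM 67 (1979), Ch. VIII §4 (periodicity), Ch. XII §3, Ch. V §2.
  [SerreLocalFields1979]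
* J. Neukirch, *Algebraic Number Theory* (1999), Ch. I §9 Prop. (9.4). [NeukirchANT1999]
* J. W. S. Cassels, A. Fröhlich (eds.), *Algebraic Number Theory* (1967), Ch. VII (Tate) §7.3.
  [CasselsFrohlichANT1967]
-/

noncomputable section

open NumberField IsDedekindDomain CategoryTheory CategoryTheory.Limits groupCohomology
open Literature.NumberTheory.Automorphic
open scoped Classical

namespace Literature.NumberTheory.GaloisRepresentations

namespace SemiLocal

open Literature.Algebra.Homology Literature.NumberTheory.NumberFields

variable {F : Type} [Field F] [NumberField F] {E : Type} [Field E] [NumberField E] [Algebra F E]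
variable {v : HeightOneSpectrum (𝓞 F)}

/-! ## §1. The decomposition group at an unramified place is cyclic -/

/-- The stabiliser of `w : Place F E v` in `Gal(E/F)` is the stabiliser of the underlying place of `E`.
[cite: CasselsFrohlichANT1967, Ch. VII §1.1] -/
theorem stabilizer_place_eq (w : Place F E v) :
    MulAction.stabilizer (E ≃ₐ[F] E) w =
      MulAction.stabilizer (E ≃ₐ[F] E) (w : HeightOneSpectrum (𝓞 E)) :=
  Subgroup.ext fun g => by
    simp only [MulAction.mem_stabilizer_iff]
    exact ⟨fun h => congrArg Place.val h, fun h => Place.ext h⟩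

/-- **The decomposition group `G_w` of a place above an unramified `v` is cyclic** (generated by the
Frobenius: tree `stabilizer_eq_zpowers_of_isArithFrobAt`, `exists_isArithFrobAt_ringOfIntegers`).
[cite: NeukirchANT1999, Ch. I §9 Prop. (9.4)] -/
theorem isCyclic_stabilizer [IsGalois F E] (w : Place F E v)
    (hunr : Algebra.IsUnramifiedIn (𝓞 E) v.asIdeal) :
    IsCyclic (MulAction.stabilizer (E ≃ₐ[F] E) w) := by
  have hQ : (w : HeightOneSpectrum (𝓞 E)).asIdeal ∈ v.asIdeal.primesOver (𝓞 E) :=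
    ⟨(w : HeightOneSpectrum (𝓞 E)).isPrime, inferInstance⟩
  obtain ⟨g, hg⟩ := exists_isArithFrobAt_ringOfIntegers (M := F) (w : HeightOneSpectrum (𝓞 E)).asIdeal
    (w : HeightOneSpectrum (𝓞 E)).ne_bot
  have h := stabilizer_eq_zpowers_of_isArithFrobAt hunr hQ hg
  have heq : MulAction.stabilizer (E ≃ₐ[F] E) w = Subgroup.zpowers g := by
    rw [stabilizer_place_eq, ← h]
    exact Subgroup.ext fun σ => by
      simp only [MulAction.mem_stabilizer_iff, HeightOneSpectrum.ext_iff, HeightOneSpectrum.smul_asIdeal]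
  rw [heq]
  infer_instance

/-- **`Gal(E_w/F_v)` is cyclic** at an unramified place (`decompMulEquiv : G_w ≃* Gal(E_w/F_v)`).
[cite: NeukirchANT1999, Ch. I §9 Prop. (9.4)][cite: CasselsFrohlichANT1967, Ch. VII §1.1] -/
theorem isCyclic_algEquiv_place [IsGalois F E] (w : Place F E v)
    (hunr : Algebra.IsUnramifiedIn (𝓞 E) v.asIdeal) :
    IsCyclic ((w : HeightOneSpectrum (𝓞 E)).adicCompletion E ≃ₐ[v.adicCompletion F]
      (w : HeightOneSpectrum (𝓞 E)).adicCompletion E) :=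
  haveI := isCyclic_stabilizer w hunr
  isCyclic_of_surjective (decompMulEquiv w) (decompMulEquiv w).surjective

/-- `e(w|v) = 1` at a place unramified in `E` (Mathlib `IsUnramifiedIn.ramificationIdx_eq_one`).
[cite: NeukirchANT1999, Ch. I §9 Prop. (9.4)] -/
theorem ramificationIdx_place_eq_one (w : Place F E v) (hunr : Algebra.IsUnramifiedIn (𝓞 E) v.asIdeal) :
    (w : HeightOneSpectrum (𝓞 E)).asIdeal.ramificationIdx (𝓞 F) = 1 :=
  hunr.ramificationIdx_eq_one (Place.liesOver w)

/-! ## §2. Periodicity: for a cyclic group `Ĥ⁰ = Ĥ¹ = 0` gives all degrees -/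

/-- For a finite cyclic group `G` and `A : Rep ℤ G`: `Ĥ⁰(G, A) = Ĥ¹(G, A) = 0 ⟹ Ĥⁿ(G, A) = 0` for every
`n ∈ ℤ` (period two: engine `FiniteCyclic.tateCohomologyIsoOfEvenIff`, on the commutative group structure
`IsCyclic.commGroup`). [cite: SerreLocalFields1979, Ch. VIII §4 Prop. 6 Corollary] -/
theorem isZero_tateCohomology_of_isCyclic {G : Type} [Group G] [Fintype G] [IsCyclic G] (A : Rep ℤ G)
    (h0 : IsZero (tateCohomology A 0)) (h1 : IsZero (tateCohomology A 1)) (n : ℤ) :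
    IsZero (tateCohomology A n) := by
  letI : CommGroup G := IsCyclic.commGroup
  obtain ⟨g, hg⟩ := IsCyclic.exists_generator (α := G)
  rcases Int.even_or_odd n with hn | hn
  · exact h0.of_iso (FiniteCyclic.tateCohomologyIsoOfEvenIff A g hg n 0 ⟨fun _ => ⟨0, rfl⟩, fun _ => hn⟩)
  · exact h1.of_iso (FiniteCyclic.tateCohomologyIsoOfEvenIff A g hg n 1
      ⟨fun h => absurd h (Int.not_even_iff_odd.mpr hn), fun h => absurd h (by decide)⟩)

/-! ## §3. Trivial cohomology of the unit modules at an unramified place -/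

/-- **`Ĥⁿ(Gal(E_w/F_v), 𝒪_wˣ) = 0` for every `n ∈ ℤ`** at a place unramified in `E` (`Ĥ⁰`: units are norms,
`isZero_tateCohomology_zero_placeUnitGroupRep`; `Ĥ¹ = H¹`: the valuation sequence,
`isZero_H1_placeUnitGroupRep`; all `n`: cyclicity and period two); for any `Fintype` structure on the
Galois group. [cite: Harari2020, Prop. 8.3 and §13.1 (proof of Prop. 13.1 (b))][cite: SerreLocalFields1979, Ch. XII §3] -/
theorem isZero_tateCohomology_placeUnitGroupRep [IsGalois F E] (w : Place F E v)
    [Fintype ((w : HeightOneSpectrum (𝓞 E)).adicCompletion E ≃ₐ[v.adicCompletion F]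
      (w : HeightOneSpectrum (𝓞 E)).adicCompletion E)]
    (hunr : Algebra.IsUnramifiedIn (𝓞 E) v.asIdeal) (n : ℤ) :
    IsZero (tateCohomology (placeUnitGroupRep w) n) :=
  haveI := isCyclic_algEquiv_place w hunr
  isZero_tateCohomology_of_isCyclic _ (isZero_tateCohomology_zero_placeUnitGroupRep w hunr)
    ((CohomologicalTriviality.isZero_tateCohomology_iff_groupCohomology _ 1).mpr
      (isZero_H1_placeUnitGroupRep w (ramificationIdx_place_eq_one w hunr))) n

/-- **`Hⁿ(Gal(E_w/F_v), 𝒪_wˣ) = 0` for every `n ≥ 1`** at a place unramified in `E`.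
[cite: Harari2020, Prop. 8.3 and §13.1 (proof of Prop. 13.1 (b))] -/
theorem isZero_groupCohomology_placeUnitGroupRep [IsGalois F E] (w : Place F E v)
    (hunr : Algebra.IsUnramifiedIn (𝓞 E) v.asIdeal) (n : ℕ) [NeZero n] :
    IsZero (groupCohomology (placeUnitGroupRep w) n) := by
  haveI := finiteDimensional_place (K := F) w
  exact (CohomologicalTriviality.isZero_tateCohomology_iff_groupCohomology _ n).mp
    (isZero_tateCohomology_placeUnitGroupRep w hunr n)

/-- **`Hⁿ(G_w, 𝒪_wˣ) = 0` for every `n ≥ 1`** (decomposition-group form) at a place unramified in `E`.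
[cite: Harari2020, §13.1 (proof of Prop. 13.1 (b))] -/
theorem isZero_groupCohomology_localIntUnitsRep [IsGalois F E] (w : Place F E v)
    (hunr : Algebra.IsUnramifiedIn (𝓞 E) v.asIdeal) (n : ℕ) [NeZero n] :
    IsZero (groupCohomology (localIntUnitsRep w) n) :=
  (isZero_groupCohomology_placeUnitGroupRep w hunr n).of_iso (groupCohomologyLocalIntUnitsRepIso w n)

/-- **`Hⁿ(Gal(E/F), ∏_{w ∣ v} 𝒪_wˣ) = 0` for every `n ≥ 1` at a place `v` unramified in `E`** — Harari's
"`Ĥ^i(G, U_K(v)) = Ĥ^i(G_v, U_{K,v}) = 0`" in positive degrees, by Shapiro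
(`isZero_groupCohomology_unitGroupRep_of_isZero`) from the local statement.
[cite: Harari2020, §13.1 (proof of Prop. 13.1 (b))][cite: CasselsFrohlichANT1967, Ch. VII §7.3] -/
theorem isZero_groupCohomology_unitGroupRep [IsGalois F E] (w : Place F E v)
    (hunr : Algebra.IsUnramifiedIn (𝓞 E) v.asIdeal) (n : ℕ) [NeZero n] :
    IsZero (groupCohomology (unitGroupRep F E v) n) :=
  isZero_groupCohomology_unitGroupRep_of_isZero w n (isZero_groupCohomology_placeUnitGroupRep w hunr n)

/-- The same with the place chosen internally: `Hⁿ(Gal(E/F), ∏_{w ∣ v} 𝒪_wˣ) = 0`, `n ≥ 1`, for `v`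
unramified in `E`. [cite: Harari2020, §13.1 (proof of Prop. 13.1 (b))] -/
theorem isZero_groupCohomology_unitGroupRep' [IsGalois F E] (v : HeightOneSpectrum (𝓞 F))
    (hunr : Algebra.IsUnramifiedIn (𝓞 E) v.asIdeal) (n : ℕ) [NeZero n] :
    IsZero (groupCohomology (unitGroupRep F E v) n) := by
  obtain ⟨w⟩ := (inferInstance : Nonempty (Place F E v))
  exact isZero_groupCohomology_unitGroupRep w hunr n

/-- Degrees `≥ 1` in Tate form together with degree `0` (`isZero_tateCohomology_zero_unitGroupRep`):
`Ĥⁿ(Gal(E/F), ∏_{w∣v} 𝒪_wˣ) = 0` for every `n ≥ 0` at a place unramified in `E`.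
[cite: Harari2020, §13.1 (proof of Prop. 13.1 (b))] -/
theorem isZero_tateCohomology_unitGroupRep_of_nonneg [IsGalois F E] (v : HeightOneSpectrum (𝓞 F))
    (hunr : Algebra.IsUnramifiedIn (𝓞 E) v.asIdeal) (n : ℕ) :
    IsZero (tateCohomology (unitGroupRep F E v) n) := by
  rcases Nat.eq_zero_or_pos n with rfl | hn
  · exact isZero_tateCohomology_zero_unitGroupRep hunr
  · haveI : NeZero n := ⟨Nat.pos_iff_ne_zero.mp hn⟩
    exact (CohomologicalTriviality.isZero_tateCohomology_iff_groupCohomology _ n).mpr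
      (isZero_groupCohomology_unitGroupRep' v hunr n)

end SemiLocal

end Literature.NumberTheory.GaloisRepresentations

end
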